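import Mathlib
import Summits.NavierStokesRegularity.NavierStokesRegularity.Theorems.L3TimeExponentPincerJawMorreyRate
import Summits.NavierStokesRegularity.NavierStokesRegularity.Theorems.L3TimeExponentPincerSerrinMorreyBridge
import Summits.NavierStokesRegularity.NavierStokesRegularity.Theorems.L3TimeExponentPincerJawFullMorreyHolds
import HarnessLib.Audit
import HarnessLib

/-!
# THEOREM J″ UNCONDITIONAL: the Morrey-RATE jaw, the power-rate clause and the `L⁵` Morrey-level criterion
# WITHOUT Maz'ya's trace inequality (route `L3TimeExponentPincer`, item `stmt-NavierStokesRegularity-19499`;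
# support file 4 of the Maz'ya-free series)

Support file (cell ns-regularity-ideate, seat p4, gen 4).  0 `sorry`, no definitions.

nsreg-p2 ROUND-9 Addenda A/B (`L3TimeExponentPincerJawMorreyRate`, `L3TimeExponentPincerSerrinMorreyBridge`) proved,
modulo the hypothesis `MazyaTraceW11` (⇐ named fact `MazyaTraceD`, Maz'ya 1985 §1.4.2 Thm 2):
J″ `jaw_of_morreyRate` (`MorreyRateNear u T Φ`, `Φ` measurable, `∫ Φ^{q/(6-q)} < ∞` ⇒ `∫_{T₂}^T ‖u‖₃^q < ∞`),
the power-law case `jaw_of_morreyPowerRate` / `l3CascadeJaw_clause_of_morreyPowerRate` (scaled energies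
`≲ (T-t)^{-1/5}` ⇒ the full `L3CascadeJaw` clause) and the `L⁵`-Morrey-level extension criterion
`hasSmoothExtensionPast_of_morreyRate_L5` (conditional on the residual `SupercriticalSerrinL3`).
The ONLY use of `MazyaTraceW11` in those proofs is the slice bound `lintegral_cube_le hMZ`; this file re-runs the
proofs verbatim with the UNCONDITIONAL slice bound `L3TimeExponentPincerJawFullMorreyHolds.sliceBound_holds`
(constant `c = 24/V₁`, from the elementary interpolation inequality of `L3TimeExponentPincerMorreyInterpolation`):

* `jaw_of_morreyRate_holds` — J″ without `MazyaTraceW11`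
  (proof adapted from `…JawMorreyRate.jaw_of_morreyRate`, nsreg-p2, first line replaced);
* `jaw_of_morreyPowerRate_holds`, `l3CascadeJaw_clause_of_morreyPowerRate_holds` — the power-rate clause,
  Maz'ya-free;
* `hasSmoothExtensionPast_of_morreyRate_L5_holds` — `SupercriticalSerrinL3 →` (`Φ ∈ L⁵(T₁,T)` ⇒ smooth extension
  past `T`), Maz'ya-free.

After this file no theorem of the route's Morrey programme (J′, J″, the Morrey pincer) depends on `MazyaTraceD`.
WHAT THIS IS NOT: not a claim about Navier–Stokes regularity; no item is closed.
-/

noncomputable section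

namespace Summit.NavierStokesRegularity.NavierStokesRegularity.Theorems.L3TimeExponentPincerJawMorreyRateHolds

open MeasureTheory Set Function Filter Metric Topology
open scoped ENNReal NNReal
open Literature.Analysis.FluidPDE
open Summit.NavierStokesRegularity.NavierStokesRegularity.Theorems.L3TimeExponentPincerMorreyGrowth
open Summit.NavierStokesRegularity.NavierStokesRegularity.Theorems.L3TimeExponentPincerJawFullMorrey
open Summit.NavierStokesRegularity.NavierStokesRegularity.Theorems.L3TimeExponentPincerJawMorreyRate
open Summit.NavierStokesRegularity.NavierStokesRegularity.Theorems.L3TimeExponentPincerSerrinMorreyBridge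
  (rpow_le_rpow_five_add_one)
open Summit.NavierStokesRegularity.NavierStokesRegularity.Theorems.L3TimeExponentPincerJawFullMorreyHolds
  (sliceBound_holds)
open Summit.NavierStokesRegularity.NavierStokesRegularity.Theses.L3TimeExponentPincer (SupercriticalSerrinL3)

/-- **THEOREM J″ (Morrey-rate jaw), UNCONDITIONAL.**  `MorreyRateNear u T Φ` with `Φ` measurable and
`∫_{T₁}^{T} Φ^{q/(6-q)} < ∞` gives `∫_{T₂}^{T} ‖u(t)‖₃^q dt < ∞` (`0 < q < 6`) — nsreg-p2's `jaw_of_morreyRate`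
without `MazyaTraceW11` (proof adapted from `…JawMorreyRate.jaw_of_morreyRate`; only the slice bound changes). -/
theorem jaw_of_morreyRate_holds {ν T : ℝ} (hν : 0 < ν) (hT : 0 < T)
    {u : ℝ → (EuclideanSpace ℝ (Fin 3)) → (EuclideanSpace ℝ (Fin 3))} {p : ℝ → (EuclideanSpace ℝ (Fin 3)) → ℝ}
    (hcl : IsClassicalNSSolutionOn (Ico 0 T) ν 0 u p) (hLH : IsLerayHopfOn T ν 0 (u 0) u)
    {Φ : ℝ → ℝ≥0} (hΦm : Measurable Φ) (hΦ : MorreyRateNear u T Φ) {q : ℝ} (hq0 : 0 < q) (hq6 : q < 6)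
    (hint : ∃ T₁' < T, ∫⁻ t in Ioo T₁' T, (Φ t : ℝ≥0∞) ^ (q / (6 - q)) < ⊤) :
    ∃ T₂ ∈ Ioo 0 T, (∫⁻ t in Ioo T₂ T, eLpNorm (u t) 3 volume ^ q) < ⊤ := by
  -- adapted from Theorems/L3TimeExponentPincerJawMorreyRate.lean `jaw_of_morreyRate` (nsreg-p2):
  -- the slice bound now comes from `sliceBound_holds` instead of `lintegral_cube_le hMZ`.
  obtain ⟨c, hc⟩ := sliceBound_holds
  obtain ⟨r₁, hr₁, T₁, hT₁, hMor⟩ := hΦ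
  obtain ⟨T₁', hT₁', hint⟩ := hint
  set e₀ : ℝ := 2 * VectorCalculus.kineticEnergy (u 0) with he₀
  have he₀nn : 0 ≤ e₀ := mul_nonneg zero_le_two (kineticEnergy_nonneg _)
  set T₂ : ℝ := max (max T₁ T₁') (T / 2) with hT₂
  have hT₂mem : T₂ ∈ Ioo 0 T :=
    ⟨lt_max_of_lt_right (by linarith), max_lt (max_lt hT₁ hT₁') (by linarith)⟩
  -- exponents
  have h6q : 0 < 6 - q := by linarith
  set a : ℝ := q / (6 - q) with ha
  set s : ℝ := 2 * q / (6 - q) with hs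
  have ha0 : 0 < a := div_pos hq0 h6q
  have hs0 : 0 < s := by positivity
  have hq3 : 0 ≤ q / 3 := by positivity
  have hα : 0 < (6 - q) / 6 := by positivity
  have hβ : 0 < q / 6 := by positivity
  have hconj : (1 / ((6 - q) / 6)).HolderConjugate (1 / (q / 6)) :=
    Real.holderConjugate_one_div hα hβ (by ring)
  have hp1 : 1 ≤ 1 / ((6 - q) / 6) := one_le_one_div hα (by linarith)
  have hp2 : 1 ≤ 1 / (q / 6) := one_le_one_div hβ (by linarith)
  have hexp1 : q / 3 * (1 / ((6 - q) / 6)) = s := by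
    rw [hs]; field_simp; ring
  have hexp2 : q / 6 * (1 / (q / 6)) = 1 := by field_simp
  have hexp3 : (1 / 2 : ℝ) * s = a := by
    rw [hs, ha]; field_simp
  have hexp4 : (1 / 2 : ℝ) * (q / 3) = q / 6 := by ring
  -- constants
  set B : ℝ≥0∞ := 2 * (ENNReal.ofReal e₀) ^ (1 / 2 : ℝ) with hB
  set C₁ : ℝ := Real.sqrt V₁ * (1 + Real.sqrt (e₀ / r₁)) with hC₁
  have hC₁nn : 0 ≤ C₁ := by positivity
  set L : ℝ≥0∞ := ((c : ℝ≥0∞) * ENNReal.ofReal C₁ * B) ^ s * (2 : ℝ≥0∞) ^ a with hL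
  have hBtop : B ≠ ⊤ :=
    ENNReal.mul_ne_top (by norm_num) (ENNReal.rpow_ne_top_of_nonneg (by norm_num) ENNReal.ofReal_ne_top)
  have hLtop : L ≠ ⊤ := by
    refine ENNReal.mul_ne_top (ENNReal.rpow_ne_top_of_nonneg hs0.le ?_)
      (ENNReal.rpow_ne_top_of_nonneg ha0.le (by norm_num))
    exact ENNReal.mul_ne_top (ENNReal.mul_ne_top ENNReal.coe_ne_top ENNReal.ofReal_ne_top) hBtop
  -- the pointwise bound at late times
  have hpt : ∀ t ∈ Ioo T₂ T,
      eLpNorm (u t) 3 volume ^ q ≤ L * ((Φ t : ℝ≥0∞) ^ a + 1) + dissipRate u t := by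
    intro t ht
    have htT₁ : T₁ < t := lt_of_le_of_lt ((le_max_left _ _).trans (le_max_left _ _)) ht.1
    have ht0 : 0 < t := hT₂mem.1.trans ht.1
    have htc : t ∈ Ico 0 T := ⟨ht0.le, ht.2⟩
    have hE : ∫⁻ y, ‖u t y‖ₑ ^ 2 ≤ ENNReal.ofReal e₀ := hLH.lintegral_enorm_sq_le hν.le ⟨ht0.le, ht.2.le⟩
    have hΦnn : 0 ≤ (Φ t : ℝ) := (Φ t).coe_nonneg
    have hMpos : 0 < (Φ t : ℝ) + 1 := by linarith
    have h1 := hc (u t) (hcl.contDiff_velocity htc) ((Φ t : ℝ) + 1) e₀ r₁ hMpos he₀nn hr₁ hE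
      (fun x₀ r hr hrr => (hMor t ⟨htT₁, ht.2⟩ x₀ r hr hrr).trans
        (ENNReal.ofReal_le_ofReal (by nlinarith)))
    -- the growth constant against `√(Φ+1)`
    have hG_le : (growthConst ((Φ t : ℝ) + 1) e₀ r₁ : ℝ≥0∞) ≤
        ENNReal.ofReal C₁ * ((Φ t : ℝ≥0∞) + 1) ^ (1 / 2 : ℝ) := by
      have hφ1 : ((Φ t : ℝ≥0∞) + 1) = ENNReal.ofReal ((Φ t : ℝ) + 1) := by
        rw [ENNReal.ofReal_add hΦnn zero_le_one, ENNReal.ofReal_coe_nnreal, ENNReal.ofReal_one]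
      rw [coe_growthConst, hφ1, ENNReal.ofReal_rpow_of_nonneg hMpos.le (by norm_num),
        ← ENNReal.ofReal_mul hC₁nn, ← Real.sqrt_eq_rpow]
      refine ENNReal.ofReal_le_ofReal ?_
      have hsq1 : 1 ≤ Real.sqrt ((Φ t : ℝ) + 1) := Real.one_le_sqrt.2 (by linarith)
      have hx : Real.sqrt ((Φ t : ℝ) + 1) + Real.sqrt (e₀ / r₁) ≤
          (1 + Real.sqrt (e₀ / r₁)) * Real.sqrt ((Φ t : ℝ) + 1) := by
        nlinarith [Real.sqrt_nonneg (e₀ / r₁), hsq1]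
      calc Real.sqrt V₁ * (Real.sqrt ((Φ t : ℝ) + 1) + Real.sqrt (e₀ / r₁))
          ≤ Real.sqrt V₁ * ((1 + Real.sqrt (e₀ / r₁)) * Real.sqrt ((Φ t : ℝ) + 1)) :=
            mul_le_mul_of_nonneg_left hx (Real.sqrt_nonneg _)
        _ = C₁ * Real.sqrt ((Φ t : ℝ) + 1) := by rw [hC₁]; ring
    -- `∫|u(t)|³ ≤ (c C₁ B) (Φ+1)^{1/2} δ^{1/2}`
    have hX : ∫⁻ y, ‖u t y‖ₑ ^ (3 : ℕ) ≤
        ((c : ℝ≥0∞) * ENNReal.ofReal C₁ * B) * ((Φ t : ℝ≥0∞) + 1) ^ (1 / 2 : ℝ) *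
          (dissipRate u t) ^ (1 / 2 : ℝ) := by
      calc ∫⁻ y, ‖u t y‖ₑ ^ (3 : ℕ)
          ≤ (c : ℝ≥0∞) * (growthConst ((Φ t : ℝ) + 1) e₀ r₁ : ℝ≥0∞) * (B * (dissipRate u t) ^ (1 / 2 : ℝ)) := h1
        _ ≤ (c : ℝ≥0∞) * (ENNReal.ofReal C₁ * ((Φ t : ℝ≥0∞) + 1) ^ (1 / 2 : ℝ)) *
              (B * (dissipRate u t) ^ (1 / 2 : ℝ)) := by gcongr
        _ = _ := by ring
    -- raise to the power `q/3`
    have hXq : eLpNorm (u t) 3 volume ^ q ≤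
        (((c : ℝ≥0∞) * ENNReal.ofReal C₁ * B) * ((Φ t : ℝ≥0∞) + 1) ^ (1 / 2 : ℝ)) ^ (q / 3) *
          (dissipRate u t) ^ (q / 6) := by
      rw [eLpNorm_three_rpow_eq]
      calc (∫⁻ y, ‖u t y‖ₑ ^ (3 : ℕ)) ^ (q / 3)
          ≤ (((c : ℝ≥0∞) * ENNReal.ofReal C₁ * B) * ((Φ t : ℝ≥0∞) + 1) ^ (1 / 2 : ℝ) *
              (dissipRate u t) ^ (1 / 2 : ℝ)) ^ (q / 3) := ENNReal.rpow_le_rpow hX hq3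
        _ = _ := by rw [ENNReal.mul_rpow_of_nonneg _ _ hq3, ← ENNReal.rpow_mul, hexp4]
    -- Young in time-pointwise form: `a b ≤ a^{6/(6-q)} + b^{6/q}`
    have hY := ENNReal.young_inequality
      ((((c : ℝ≥0∞) * ENNReal.ofReal C₁ * B) * ((Φ t : ℝ≥0∞) + 1) ^ (1 / 2 : ℝ)) ^ (q / 3))
      ((dissipRate u t) ^ (q / 6)) hconj
    have hKP : ((((c : ℝ≥0∞) * ENNReal.ofReal C₁ * B) * ((Φ t : ℝ≥0∞) + 1) ^ (1 / 2 : ℝ)) ^ (q / 3)) ^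
        (1 / ((6 - q) / 6)) ≤ L * ((Φ t : ℝ≥0∞) ^ a + 1) := by
      rw [← ENNReal.rpow_mul, hexp1, ENNReal.mul_rpow_of_nonneg _ _ hs0.le, ← ENNReal.rpow_mul, hexp3, hL]
      calc ((c : ℝ≥0∞) * ENNReal.ofReal C₁ * B) ^ s * ((Φ t : ℝ≥0∞) + 1) ^ a
          ≤ ((c : ℝ≥0∞) * ENNReal.ofReal C₁ * B) ^ s * ((2 : ℝ≥0∞) ^ a * ((Φ t : ℝ≥0∞) ^ a + 1)) := by
            gcongr; exact add_one_rpow_le _ ha0.le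
        _ = _ := (mul_assoc _ _ _).symm
    have hD : ((dissipRate u t) ^ (q / 6)) ^ (1 / (q / 6)) = dissipRate u t := by
      rw [← ENNReal.rpow_mul, hexp2, ENNReal.rpow_one]
    calc eLpNorm (u t) 3 volume ^ q
        ≤ _ := hXq
      _ ≤ _ := hY
      _ ≤ ((((c : ℝ≥0∞) * ENNReal.ofReal C₁ * B) * ((Φ t : ℝ≥0∞) + 1) ^ (1 / 2 : ℝ)) ^ (q / 3)) ^
              (1 / ((6 - q) / 6)) + ((dissipRate u t) ^ (q / 6)) ^ (1 / (q / 6)) :=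
          add_le_add (div_ofReal_le_self _ hp1) (div_ofReal_le_self _ hp2)
      _ ≤ L * ((Φ t : ℝ≥0∞) ^ a + 1) + dissipRate u t := by rw [hD]; exact add_le_add hKP le_rfl
  -- integrate in time
  refine ⟨T₂, hT₂mem, ?_⟩
  have hdiss : ∫⁻ t in Ioo 0 T, dissipRate u t < ⊤ := dissip_lt_top hcl hLH
  have hmΦa : Measurable fun t => (Φ t : ℝ≥0∞) ^ a := hΦm.coe_nnreal_ennreal.pow_const a
  have hmF : Measurable fun t => L * ((Φ t : ℝ≥0∞) ^ a + 1) := (hmΦa.add_const 1).const_mul L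
  have hT₁'T₂ : T₁' ≤ T₂ := (le_max_right T₁ T₁').trans (le_max_left _ _)
  calc ∫⁻ t in Ioo T₂ T, eLpNorm (u t) 3 volume ^ q
      ≤ ∫⁻ t in Ioo T₂ T, (L * ((Φ t : ℝ≥0∞) ^ a + 1) + dissipRate u t) :=
        setLIntegral_mono' measurableSet_Ioo hpt
    _ = (∫⁻ t in Ioo T₂ T, L * ((Φ t : ℝ≥0∞) ^ a + 1)) + ∫⁻ t in Ioo T₂ T, dissipRate u t :=
        lintegral_add_left hmF _
    _ = L * ((∫⁻ t in Ioo T₂ T, (Φ t : ℝ≥0∞) ^ a) + ∫⁻ t in Ioo T₂ T, (1 : ℝ≥0∞)) +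
          ∫⁻ t in Ioo T₂ T, dissipRate u t := by
        rw [lintegral_const_mul L (hmΦa.add_const 1), lintegral_add_left hmΦa]
    _ < ⊤ := by
        refine ENNReal.add_lt_top.2 ⟨ENNReal.mul_lt_top hLtop.lt_top (ENNReal.add_lt_top.2 ⟨?_, ?_⟩), ?_⟩
        · exact lt_of_le_of_lt (lintegral_mono_set (Ioo_subset_Ioo_left hT₁'T₂)) hint
        · rw [setLIntegral_const, Real.volume_Ioo]
          exact ENNReal.mul_lt_top ENNReal.one_lt_top ENNReal.ofReal_lt_top
        · exact lt_of_le_of_lt (lintegral_mono_set (Ioo_subset_Ioo_left hT₂mem.1.le)) hdiss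

/-- **Power-law Morrey rate, UNCONDITIONAL**: scaled energies growing at most like `M (T-t)^{-β}` give the
clause for every `0 < q < 6` with `β q < 6 - q` (nsreg-p2's `jaw_of_morreyPowerRate` without `MazyaTraceW11`). -/
theorem jaw_of_morreyPowerRate_holds {ν T : ℝ} (hν : 0 < ν) (hT : 0 < T)
    {u : ℝ → (EuclideanSpace ℝ (Fin 3)) → (EuclideanSpace ℝ (Fin 3))} {p : ℝ → (EuclideanSpace ℝ (Fin 3)) → ℝ}
    (hcl : IsClassicalNSSolutionOn (Ico 0 T) ν 0 u p) (hLH : IsLerayHopfOn T ν 0 (u 0) u)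
    {M β r₁ T₁ : ℝ} (hM : 0 ≤ M) (hr₁ : 0 < r₁) (hT₁ : T₁ < T)
    (hMor : ∀ t ∈ Ioo T₁ T, ∀ x₀ : (EuclideanSpace ℝ (Fin 3)), ∀ r : ℝ, 0 < r → r < r₁ →
      ∫⁻ x in ball x₀ r, ‖u t x‖ₑ ^ 2 ≤ ENNReal.ofReal (M * (T - t) ^ (-β) * r))
    {q : ℝ} (hq0 : 0 < q) (hq6 : q < 6) (hβq : β * q < 6 - q) :
    ∃ T₂ ∈ Ioo 0 T, (∫⁻ t in Ioo T₂ T, eLpNorm (u t) 3 volume ^ q) < ⊤ := by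
  -- adapted from `…JawMorreyRate.jaw_of_morreyPowerRate` (nsreg-p2), `jaw_of_morreyRate_holds` in place of J″.
  have h6q : 0 < 6 - q := by linarith
  set Φ : ℝ → ℝ≥0 := fun t => (M * (T - t) ^ (-β)).toNNReal with hΦ
  have hΦm : Measurable Φ :=
    (measurable_const.mul ((measurable_const.sub measurable_id).pow_const _)).real_toNNReal
  have hΦval : ∀ t, t < T → (Φ t : ℝ) = M * (T - t) ^ (-β) := fun t ht => by
    rw [hΦ]
    exact Real.coe_toNNReal _ (mul_nonneg hM (Real.rpow_nonneg (by linarith) _))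
  have hrate : MorreyRateNear u T Φ :=
    ⟨r₁, hr₁, T₁, hT₁, fun t ht x₀ r hr hrr => by rw [hΦval t ht.2]; exact hMor t ht x₀ r hr hrr⟩
  refine jaw_of_morreyRate_holds hν hT hcl hLH hΦm hrate hq0 hq6 ⟨T₁, hT₁, ?_⟩
  have ha0 : 0 < q / (6 - q) := div_pos hq0 h6q
  have hγ : β * (q / (6 - q)) < 1 := by rw [← mul_div_assoc, div_lt_one h6q]; exact hβq
  have hpt : ∀ t ∈ Ioo T₁ T, (Φ t : ℝ≥0∞) ^ (q / (6 - q)) =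
      ENNReal.ofReal (M ^ (q / (6 - q)) * (T - t) ^ (-(β * (q / (6 - q))))) := by
    intro t ht
    have hTt : 0 < T - t := by linarith [ht.2]
    rw [← ENNReal.ofReal_coe_nnreal, hΦval t ht.2, ENNReal.ofReal_rpow_of_nonneg (by
      exact mul_nonneg hM (Real.rpow_nonneg hTt.le _)) ha0.le,
      Real.mul_rpow hM (Real.rpow_nonneg hTt.le _), ← Real.rpow_mul hTt.le, neg_mul]
  calc ∫⁻ t in Ioo T₁ T, (Φ t : ℝ≥0∞) ^ (q / (6 - q))
      = ∫⁻ t in Ioo T₁ T, ENNReal.ofReal (M ^ (q / (6 - q)) * (T - t) ^ (-(β * (q / (6 - q))))) :=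
        setLIntegral_congr_fun measurableSet_Ioo hpt
    _ < ⊤ := lintegral_Ioo_rpow_neg_lt_top hT₁ hγ

/-- **The `L3CascadeJaw` clause under a `(T-t)^{-1/5}` Morrey rate, UNCONDITIONAL**: every `q ∈ (4,5)` for frame
solutions whose scaled energies grow at most like `(T-t)^{-1/5}` (nsreg-p2's
`l3CascadeJaw_clause_of_morreyPowerRate` without `MazyaTraceD`). -/
theorem l3CascadeJaw_clause_of_morreyPowerRate_holds (q : ℝ) (hq4 : 4 < q) (hq5 : q < 5)
    (ν T : ℝ) (hν : 0 < ν) (hT : 0 < T)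
    (u : ℝ → (EuclideanSpace ℝ (Fin 3)) → (EuclideanSpace ℝ (Fin 3))) (p : ℝ → (EuclideanSpace ℝ (Fin 3)) → ℝ)
    (hcl : IsClassicalNSSolutionOn (Ico 0 T) ν 0 u p) (hLH : IsLerayHopfOn T ν 0 (u 0) u)
    {M β r₁ T₁ : ℝ} (hM : 0 ≤ M) (hβ : β ≤ 1 / 5) (hr₁ : 0 < r₁) (hT₁ : T₁ < T)
    (hMor : ∀ t ∈ Ioo T₁ T, ∀ x₀ : (EuclideanSpace ℝ (Fin 3)), ∀ r : ℝ, 0 < r → r < r₁ →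
      ∫⁻ x in ball x₀ r, ‖u t x‖ₑ ^ 2 ≤ ENNReal.ofReal (M * (T - t) ^ (-β) * r)) :
    ∃ T₂ ∈ Ioo 0 T, (∫⁻ t in Ioo T₂ T, eLpNorm (u t) 3 volume ^ q) < ⊤ :=
  jaw_of_morreyPowerRate_holds hν hT hcl hLH hM hr₁ hT₁ hMor (by linarith) (by linarith) (by nlinarith)

/-- **The `L⁵` Morrey-LEVEL extension criterion through the residual, Maz'ya-free**: modulo the residual crux
`SupercriticalSerrinL3` only, a frame solution whose worst-ball scaled energy has a measurable majorant `Φ` with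
`∫_{T₁}^{T} Φ⁵ < ∞` extends smoothly past `T` (nsreg-p2's `hasSmoothExtensionPast_of_morreyRate_L5` without
`MazyaTraceD`). -/
theorem hasSmoothExtensionPast_of_morreyRate_L5_holds (h : SupercriticalSerrinL3)
    {ν T : ℝ} (hν : 0 < ν) (hT : 0 < T)
    {u : ℝ → (EuclideanSpace ℝ (Fin 3)) → (EuclideanSpace ℝ (Fin 3))} {p : ℝ → (EuclideanSpace ℝ (Fin 3)) → ℝ}
    (hcl : IsClassicalNSSolutionOn (Ico 0 T) ν 0 u p) (hLH : IsLerayHopfOn T ν 0 (u 0) u)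
    (hdec : HasRapidSpatialDecay (u 0)) {Φ : ℝ → ℝ≥0} (hΦm : Measurable Φ) (hΦ : MorreyRateNear u T Φ)
    (hint : ∃ T₁ < T, ∫⁻ t in Ioo T₁ T, (Φ t : ℝ≥0∞) ^ (5 : ℝ) < ⊤) :
    HasSmoothExtensionPast ν 0 u T := by
  -- adapted from `…SerrinMorreyBridge.hasSmoothExtensionPast_of_morreyRate_L5` (nsreg-p2).
  obtain ⟨q, hq4, hq5, hS⟩ := h
  obtain ⟨T₁, hT₁, hint⟩ := hint
  have h6q : 0 < 6 - q := by linarith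
  have ha0 : 0 ≤ q / (6 - q) := (div_pos (by linarith) h6q).le
  have ha5 : q / (6 - q) ≤ 5 := by rw [div_le_iff₀ h6q]; linarith
  refine hS ν T hν hT u p hcl hLH hdec
    (jaw_of_morreyRate_holds hν hT hcl hLH hΦm hΦ (by linarith) (by linarith) ⟨T₁, hT₁, ?_⟩)
  calc ∫⁻ t in Ioo T₁ T, (Φ t : ℝ≥0∞) ^ (q / (6 - q))
      ≤ ∫⁻ t in Ioo T₁ T, ((Φ t : ℝ≥0∞) ^ (5 : ℝ) + 1) :=
        lintegral_mono fun t => rpow_le_rpow_five_add_one _ ha0 ha5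
    _ = (∫⁻ t in Ioo T₁ T, (Φ t : ℝ≥0∞) ^ (5 : ℝ)) + ∫⁻ t in Ioo T₁ T, (1 : ℝ≥0∞) :=
        lintegral_add_right' _ aemeasurable_const
    _ < ⊤ := by
        refine ENNReal.add_lt_top.2 ⟨hint, ?_⟩
        rw [setLIntegral_const, Real.volume_Ioo]
        exact ENNReal.mul_lt_top ENNReal.one_lt_top ENNReal.ofReal_lt_top

end Summit.NavierStokesRegularity.NavierStokesRegularity.Theorems.L3TimeExponentPincerJawMorreyRateHolds

end
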